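import Literature.AlgebraicGeometry.Resolution.ResolutionProjectiveReduction
import Literature.AlgebraicGeometry.Resolution.AlterationsStrong

/-!
# `WeightedInvariant.WeightedThesis`, line `datum-glued-split`: the projective integral case suffices

Route `ResolutionOfSingularities/WeightedInvariant`, crux `WeightedThesis`
(stmt-ResolutionOfSingularities-0569), stub `stub_projectiveIntegralSuffices` of the lead's
skeleton `work/WeightedThesis.lean`, PROVED here (statement verbatim from the ledger
registration).

**Statement (Cossart–Piltant 2019, proof of Prop. 4.6, Steps 1–3; Zariski–Samuel II, Ch. VI
§17).** Let `k` be any field. If every integral scheme `X` admitting a closed immersion into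
some projective space `ℙⁿ_k` has a resolution of singularities (`Scheme.HasResolution`: a proper
birational morphism from a regular scheme), then so does every reduced separated `k`-scheme of
finite type `f : X → Spec k`.

**Proof.** Pure tree glue. `X` is quasi-compact over the compact `Spec k`, hence a compact
space, so it has finite dimension `d` (`exists_topologicalKrullDim_le_of_locallyOfFiniteType`,
Stacks 01TB/00OS). The tree's reduction `ResolutionOverUpToDim.of_projective` (irreducible
components with the reduced structure, Chow's lemma in integral form, projective closure,
transport of resolutions along open immersions and proper birational morphisms) turns the
hypothesis — with the dimension bound forgotten — into `ResolutionOverUpToDim k d`, which applies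
to `f`.
-/

noncomputable section

set_option linter.dupNamespace false -- mandated namespace of this single-conjunct summit

open CategoryTheory AlgebraicGeometry Literature.AlgebraicGeometry.Resolution

namespace Summit.ResolutionOfSingularities.ResolutionOfSingularities.Theorems.WeightedThesis.ProjectiveIntegralSuffices

/-- **The projective integral case suffices (every field).** If every integral closed subscheme
of every projective space `ℙⁿ_k` has a resolution of singularities, then every reduced
separated `k`-scheme of finite type has one: irreducible components, Chow's lemma and projective
closure (`ResolutionOverUpToDim.of_projective`), applied in the finite dimension of `X`
(`exists_topologicalKrullDim_le_of_locallyOfFiniteType`).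
[cite: CossartPiltant2019, Prop. 4.6 (proof, Steps 1–3)] -/
theorem stub_projectiveIntegralSuffices : ∀ (k : Type) [Field k], (∀ (n : ℕ) (X : Scheme.{0}) (ι : X ⟶ (Literature.AlgebraicGeometry.Motives.projectiveSpace n k).left), IsClosedImmersion ι → IsIntegral X → Scheme.HasResolution X) → ∀ (X : Scheme.{0}) (f : X ⟶ Spec (.of k)), IsSeparated f → LocallyOfFiniteType f → QuasiCompact f → IsReduced X → Scheme.HasResolution X := by
  intro k _ h X f hsep hlft hqc hred
  haveI : LocallyOfFiniteType f := hlft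
  haveI : QuasiCompact f := hqc
  haveI : CompactSpace X := QuasiCompact.compactSpace_of_compactSpace f
  -- `X` is of finite type over `k`, hence finite-dimensional
  obtain ⟨d, hd⟩ := exists_topologicalKrullDim_le_of_locallyOfFiniteType f
  -- the tree's reduction to integral closed subschemes of `ℙⁿ_k` of dimension `≤ d`
  exact ResolutionOverUpToDim.of_projective (k := k) (d := d)
    (fun n Z ι hι hint _ => h n Z ι hι hint) X f hsep hlft hqc hred hd

end Summit.ResolutionOfSingularities.ResolutionOfSingularities.Theorems.WeightedThesis.ProjectiveIntegralSuffices

end
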